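import Literature.AlgebraicGeometry.HodgeTheory.GAGADimensionProofs
import Literature.AlgebraicGeometry.HodgeTheory.GysinFormalismPushforward
import Literature.Geometry.Kaehler.RegularPointStraightening
import HarnessLib

/-!
# Zariski-closed subsets of smooth projective complex varieties are locally flat in `X(ℂ)` off a closed subset of larger codimension (Serre, GAGA §6 Cor. 3 at simple points; Voisin I, Thm. 11.11 for algebraic sets)

C. Voisin, *Hodge Theory and Complex Algebraic Geometry I* (2002), Thm. 11.11: an analytic subset
`Z` has a filtration `∅ = Z_{n+1} ⊂ ⋯ ⊂ Z₀ = Z` by closed analytic subsets with `Z_k − Z_{k+1}`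
a closed complex submanifold of `X − Z_{k+1}`. For a ZARISKI-closed `Z ⊆ X`, `X` smooth
projective over `ℂ`, this file proves the one step of such a filtration that the semipurity of the
coniveau filtration needs (`HodgeTheory/SupportedClassesSemipurity`), in the form consumed by
`Literature.AlgebraicTopology.SingularHomology.surjective_injective_map_compl_of_locallyFlat`:

* `exists_closed_straightening_off` — **if every scheme point of the Zariski-closed `Z` has
  codimension `≥ c`, there is a Zariski-closed `Z₁ ⊆ Z` all of whose points have codimension
  `≥ c + 1`, such that at every complex point `P` with `pt P ∈ Z ∖ Z₁` the subset
  `Z(ℂ) = {Q | pt Q ∈ Z}` of `X(ℂ)` (strong topology) is straightened by an open partial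
  homeomorphism `e : X(ℂ) ⇀ ℂ^{c'} × K`, `c ≤ c'`: `pt Q ∈ Z ↔ (e Q).1 = 0` on `e.source ∋ P`.**

The proof is Serre's comparison at SIMPLE points (GAGA §1 n°4, §2 n°6 Cor. 2, §6 Cor. 3), for
which the tree has the complete pipeline of `HodgeTheory/GAGADimension{Algebra,SimplePoint,Charts,
RegularPoint,Proofs}` (there used to produce ONE simple point per component; here run at EVERY
good point): in a standard smooth affine chart `U = Spec A ∋ pt P`, with `I` the ideal of `Z ∩ U`,
a minimal prime `𝔭 ⊇ I` isolated off `V(h)` (`exists_minimalPrime_forall_iff`), generators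
`g₁, …, g_{c'}` of `𝔭` off `V(h')` (`exists_mul_mem_span_of_isRegularLocalRing`, `c' = ht 𝔭 ≥ c`),
a complex point `P` is GOOD if `h h' ∉ 𝔪_P` and `A/𝔭` is smooth at `𝔪_P/𝔭`; then the `gⱼ` are
independent modulo `𝔪_P²` and `A` has local coordinates at `𝔪_P`
(`simplePointData_of_isRegularLocalRing`, the pointwise form of `exists_simplePointData`), so `P`
is a regular point of codimension `c'` of `Z(ℂ)` in the algebraic-chart model of `X^h`
(`isRegularPointOfCodim_of_simplePoint`, `exists_algebraicChart_holds`), hence has a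
straightening chart (`IsRegularPointOfCodim.exists_straightening`,
`Geometry/Kaehler/RegularPointStraightening`: Osgood + implicit functions). The good points form
an open subset of `Z` containing the generic point of every irreducible component (generic
smoothness, `isSmoothAt_bot`), so the bad set `Z₁` is closed of codimension `≥ c + 1`.

Everything is proved; no definitions, no named facts.

## References

* [SerreGAGA1956] J.-P. Serre, Géométrie algébrique et géométrie analytique, Ann. Inst. Fourier 6
  (1956), §1 n°4, §2 n°6 Prop. 3 Cor. 2, §6 Prop. 3 Cor. 3 (p. 11).
* [VoisinHodgeI2002] C. Voisin, Hodge Theory and Complex Algebraic Geometry I, CUP 2002, §11.1.1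
  Thm. 11.11, §11.1.2 Lemma 11.13.
* [GortzWedhorn2020] U. Görtz, T. Wedhorn, Algebraic Geometry I, 2nd ed. 2020, Thm. 6.19,
  Lemma 6.26 (generic smoothness).
-/

noncomputable section

open scoped Manifold ContDiff Topology
open CategoryTheory AlgebraicGeometry Filter IsLocalRing
open Literature.AlgebraicGeometry.Motives
open Literature.AlgebraicGeometry.Motives.AlgPoints (evalOrZero evalOrZero_of_mem evalOrZero_of_not_mem)
open Literature.NumberTheory.Transcendental

namespace Literature.AlgebraicGeometry.HodgeTheory

namespace GAGADimension

/-! ### Algebra: regularity on the smooth locus; the simple-point data at a given good point -/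

section Algebra

/-- On the smooth locus of a finitely generated algebra over a field the local rings are regular
(a standard smooth neighbourhood, Mathlib `Algebra.IsSmoothAt.exists_notMem_isStandardSmooth`,
and the tree's `Motives.isRegularLocalRing_of_isStandardSmoothOfRelativeDimension`; the argument of
`exists_isMaximal_isRegularLocalRing`, at an arbitrary prime). [cite: GortzWedhorn2020, Thm. 6.19 and Lemma 6.26] -/
theorem isRegularLocalRing_of_mem_smoothLocus (K : Type*) [Field K] (B : Type*) [CommRing B]
    [Algebra K B] [Algebra.FinitePresentation K B] (x : PrimeSpectrum B)
    (hx : x ∈ Algebra.smoothLocus K B) : IsRegularLocalRing (Localization.AtPrime x.asIdeal) := by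
  haveI : Algebra.IsSmoothAt K x.asIdeal := hx
  obtain ⟨f, hf, hstd⟩ := Algebra.IsSmoothAt.exists_notMem_isStandardSmooth K x.asIdeal
  obtain ⟨ι, τ, _, _, ⟨P⟩⟩ := hstd.out
  haveI := P.isStandardSmoothOfRelativeDimension rfl
  have hdisj : Disjoint (Submonoid.powers f : Set B) x.asIdeal := by
    rw [Ideal.disjoint_powers_iff_notMem_of_isPrime]
    exact hf
  set 𝔫' : Ideal (Localization.Away f) := x.asIdeal.map (algebraMap B _) with h𝔫'
  haveI : 𝔫'.IsPrime := IsLocalization.isPrime_of_isPrime_disjoint (.powers f) _ _ x.2 hdisj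
  have hreg := Literature.AlgebraicGeometry.Motives.isRegularLocalRing_of_isStandardSmoothOfRelativeDimension
    K P.dimension 𝔫'
  have hunder : 𝔫'.comap (algebraMap B (Localization.Away f)) = x.asIdeal :=
    IsLocalization.under_map_of_isPrime_disjoint (.powers f) _ x.2 hdisj
  let e := IsLocalization.localizationLocalizationAtPrimeIsoLocalization (Submonoid.powers f) 𝔫'
  haveI := hreg
  have hreg' : IsRegularLocalRing
      (Localization.AtPrime (𝔫'.comap (algebraMap B (Localization.Away f)))) :=
    IsRegularLocalRing.of_ringEquiv e.symm.toRingEquiv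
  have transfer : ∀ (J : Ideal B) (hJ : J.IsPrime), J = x.asIdeal →
      IsRegularLocalRing (Localization.AtPrime J) →
      IsRegularLocalRing (Localization.AtPrime x.asIdeal) := by
    rintro J hJ rfl h
    exact h
  exact transfer _ inferInstance hunder hreg'

/-- **The simple-point data at a GIVEN good point** (the pointwise form of
`exists_simplePointData`; Serre GAGA §1 n°4, §2 n°6 Cor. 2). Let `A` be a domain, standard smooth
of relative dimension `n` over the algebraically closed `K`, `𝔭 ⊂ A` a prime of height `c`,
`g₁, …, g_c ∈ 𝔭` and `h'` with `h' · 𝔭 ⊆ (g)`, and `ψ : A →ₐ K` a `K`-rational point whose kernel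
`𝔪` is the contraction of a prime `x` of `A/𝔭` (so `𝔭 ⊆ 𝔪`) at which `A/𝔭` has a regular local
ring, with `h' ∉ 𝔪`. Then the `gⱼ` are linearly independent modulo `𝔪²` over `K`, and `A` has
local coordinates `t₁, …, tₙ ∈ 𝔪` modulo `𝔪²`. [cite: SerreGAGA1956, §6 Prop. 3 Cor. 2–3 (p. 11) with §1 n°4]
[cite: GortzWedhorn2020, Thm. 6.19 and Lemma 6.26] -/
theorem simplePointData_of_isRegularLocalRing (K : Type*) [Field K] [IsAlgClosed K]
    (A : Type*) [CommRing A] [IsDomain A] [Algebra K A] (n : ℕ)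
    [Algebra.IsStandardSmoothOfRelativeDimension n K A] (𝔭 : Ideal A) [𝔭.IsPrime] {c : ℕ}
    (hc : (c : ℕ∞) = 𝔭.height) (g : Fin c → A) (hg : ∀ j, g j ∈ 𝔭) (h' : A)
    (hgen : ∀ a ∈ 𝔭, h' * a ∈ Ideal.span (Set.range g)) (ψ : A →ₐ[K] K)
    (x : PrimeSpectrum (A ⧸ 𝔭)) (hx : x.asIdeal.comap (Ideal.Quotient.mk 𝔭) = RingHom.ker ψ)
    (hreg : IsRegularLocalRing (Localization.AtPrime x.asIdeal))
    (hh' : h' ∉ RingHom.ker ψ) :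
    (∀ coef : Fin c → K, ∑ j, coef j • g j ∈ RingHom.ker ψ ^ 2 → coef = 0) ∧
      ∃ t : Fin n → A, (∀ i, t i ∈ RingHom.ker ψ) ∧
        ∀ a ∈ RingHom.ker ψ, ∃ coef : Fin n → K, a - ∑ i, coef i • t i ∈ RingHom.ker ψ ^ 2 := by
  classical
  haveI : Algebra.IsStandardSmooth K A :=
    Algebra.IsStandardSmoothOfRelativeDimension.isStandardSmooth n
  haveI : Algebra.FiniteType K A := inferInstance
  haveI : IsNoetherianRing A := Algebra.FiniteType.isNoetherianRing K A
  have hdimA : ringKrullDim A = n :=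
    Literature.AlgebraicGeometry.Motives.ringKrullDim_eq_of_isStandardSmoothOfRelativeDimension K n
  -- the `K`-rational maximal ideal `𝔪 = ker ψ = x ∩ A`
  rw [← hx] at hh' ⊢
  set 𝔫 : Ideal (A ⧸ 𝔭) := x.asIdeal with h𝔫def
  set 𝔪 : Ideal A := 𝔫.comap (Ideal.Quotient.mk 𝔭) with h𝔪def
  have hψsurj : Function.Surjective ψ := fun y ↦ ⟨algebraMap K A y, by simp⟩
  haveI h𝔪max : 𝔪.IsMaximal := by
    rw [hx]
    exact RingHom.ker_isMaximal_of_surjective ψ.toRingHom hψsurj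
  have hψ : ∀ a, ψ a = 0 ↔ a ∈ 𝔪 := fun a ↦ by
    rw [hx, RingHom.mem_ker]
  have h𝔭𝔪 : 𝔭 ≤ 𝔪 := fun a ha ↦ by
    change Ideal.Quotient.mk 𝔭 a ∈ 𝔫
    rw [Ideal.Quotient.eq_zero_iff_mem.2 ha]
    exact zero_mem _
  -- `𝔫` is maximal: it is `𝔪/𝔭`
  haveI h𝔫max : 𝔫.IsMaximal := by
    have hmap : 𝔪.map (Ideal.Quotient.mk 𝔭) = 𝔫 :=
      Ideal.map_comap_of_surjective _ Ideal.Quotient.mk_surjective 𝔫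
    rcases Ideal.map_eq_top_or_isMaximal_of_surjective (Ideal.Quotient.mk 𝔭)
      Ideal.Quotient.mk_surjective h𝔪max with htop | hmax
    · exfalso
      apply h𝔪max.ne_top
      have h1 := congrArg (Ideal.comap (Ideal.Quotient.mk 𝔭)) htop
      rw [hmap, Ideal.comap_top] at h1
      exact h1
    · rwa [hmap] at hmax
  haveI : IsRegularLocalRing (Localization.AtPrime 𝔫) := hreg
  -- `B = A/𝔭` has dimension `d` with `c + d = n`
  obtain ⟨d, hd⟩ := Literature.AlgebraicGeometry.Motives.exists_ringKrullDim_eq_natCast K (A ⧸ 𝔭)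
  have hcd : c + d = n := by
    have h1 := Literature.AlgebraicGeometry.Motives.Ideal.height_add_ringKrullDim_quotient K A 𝔭
    rw [← hc, hd, hdimA] at h1
    exact_mod_cast h1
  -- `(A/𝔭)_𝔫` has dimension `d`
  have hdim𝔫 : ringKrullDim (Localization.AtPrime 𝔫) = d := by
    let y : PrimeSpectrum (A ⧸ 𝔭) := ⟨𝔫, h𝔫max.isPrime⟩
    have h1 := Literature.AlgebraicGeometry.Motives.height_add_coheight_eq_of_isDomain K d (A ⧸ 𝔭) hd y
    have h2 : Order.coheight y = 0 := by
      rw [Order.coheight_eq_zero]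
      intro z hz
      have : z.asIdeal = 𝔫 := (h𝔫max.eq_of_le z.2.ne_top hz).symm
      exact le_of_eq (PrimeSpectrum.ext this)
    rw [h2, add_zero] at h1
    rw [IsLocalization.AtPrime.ringKrullDim_eq_height 𝔫,
      show 𝔫 = y.asIdeal from rfl, PrimeSpectrum.height_eq_orderHeight, h1]
    rfl
  obtain ⟨s, hs, hspan⟩ := maximalIdeal_le_span_of_quotient 𝔭 𝔫 hdim𝔫 g h' hh' hgen
  -- `A_𝔪` is regular of dimension `n = c + d`
  have hdim𝔪 : ringKrullDim (Localization.AtPrime 𝔪) = (c + d : ℕ) := by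
    rw [IsLocalization.AtPrime.ringKrullDim_eq_height 𝔪,
      Literature.AlgebraicGeometry.Motives.height_eq_of_isStandardSmoothOfRelativeDimension K n 𝔪, hcd]
    rfl
  have hindep : ∀ coef : Fin c → K, ∑ j, coef j • g j ∈ 𝔪 ^ 2 → coef = 0 := fun coef hmem ↦
    eq_zero_of_sum_smul_mem_sq K 𝔪 hdim𝔪 g s (fun j ↦ h𝔭𝔪 (hg j)) hs hspan coef hmem
  -- local coordinates at `𝔪`
  haveI := Literature.AlgebraicGeometry.Motives.isRegularLocalRing_of_isStandardSmoothOfRelativeDimension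
    K n 𝔪
  have hdim𝔪' : ringKrullDim (Localization.AtPrime 𝔪) = n := by rw [hdim𝔪, hcd]
  obtain ⟨t, ht, htspan⟩ := exists_sub_sum_smul_mem_sq K 𝔪 hdim𝔪' ψ hψ
  exact ⟨hindep, t, ht, htspan⟩

end Algebra

/-! ### Geometry: the straightening chart at a good complex point -/

section Point

variable {n : ℕ} {X : SchemeOver ℂ}

/-- **A good complex point of `Z` is straightened** (Serre, GAGA §6 Cor. 3 at a simple point, in the
tree's algebraic-chart model of `X^h`, followed by the holomorphic implicit function theorem). Let
`X` be smooth projective of dimension `n` over `ℂ`, `Z ⊆ X` a subset, `U = Spec A` an affine open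
with `A` standard smooth of relative dimension `n` over `ℂ` (canonical scalars), `𝔭 ⊂ A` a prime of
height `c` with `g₁, …, g_c ∈ 𝔭`, `h' · 𝔭 ⊆ (g)`, and such that off `V(h)` a point of `U` lies in
`Z` iff it lies in `V(𝔭)`. Let `P` be a complex point of `U` with `(h h')(P) ≠ 0` whose maximal
ideal `𝔪_P = ker (evaluation at P)` is the contraction of a prime `x` of `A/𝔭` at which `A/𝔭` is
regular. Then `Z(ℂ) = {Q | pt Q ∈ Z}` is straightened at `P`: there are a subspace `K ⊆ ℂⁿ` and an
open partial homeomorphism `e : X(ℂ) ⇀ ℂᶜ × K` with `P ∈ e.source` and `pt Q ∈ Z ↔ (e Q).1 = 0` on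
`e.source`. Proof: the simple-point data at `𝔪_P` (`simplePointData_of_isRegularLocalRing`) make `P`
a regular point of codimension `c` of `Z(ℂ)` for the algebraic-chart atlas
(`isRegularPointOfCodim_of_simplePoint`, `exists_algebraicChart_holds`), and regular points are
locally flat (`IsRegularPointOfCodim.exists_straightening`).
[cite: SerreGAGA1956, §6 Prop. 3 Cor. 2–3 (p. 11) with §1 n°4 and §2 n°6 Cor. 2] -/
theorem exists_straightening_of_witnesses (hX : Motives.IsSmoothProjective n X) {Z : Set X.left}
    (U : X.left.affineOpens)
    (hsm : RingHom.IsStandardSmoothOfRelativeDimension n (SchemeOver.scalarRingHom X ↑U))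
    (𝔭 : Ideal Γ(X.left, ↑U)) [𝔭.IsPrime] {c : ℕ} (hc : (c : ℕ∞) = 𝔭.height)
    (g : Fin c → Γ(X.left, ↑U)) (hg : ∀ j, g j ∈ 𝔭) (h h' : Γ(X.left, ↑U))
    (hgen : ∀ a ∈ 𝔭, h' * a ∈ Ideal.span (Set.range g))
    (hiso : ∀ q : PrimeSpectrum Γ(X.left, ↑U), h ∉ q.asIdeal →
      (U.2.fromSpec.base q ∈ Z ↔ 𝔭 ≤ q.asIdeal))
    (P : ComplexPoints X) (hPU : P.pt ∈ (↑U : X.left.Opens))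
    (x : PrimeSpectrum (Γ(X.left, ↑U) ⧸ 𝔭))
    (hx : x.asIdeal.comap (Ideal.Quotient.mk 𝔭) = RingHom.ker (P.evalRingHom ↑U hPU))
    (hreg : IsRegularLocalRing (Localization.AtPrime x.asIdeal))
    (hhP : P.eval ↑U hPU (h * h') ≠ 0) :
    ∃ (K : Submodule ℂ (Fin n → ℂ))
      (e : OpenPartialHomeomorph (ComplexPoints X) ((Fin c → ℂ) × K)),
      P ∈ e.source ∧ ∀ Q ∈ e.source, Q.pt ∈ Z ↔ (e Q).1 = 0 := by
  classical
  have hU : IsAffineOpen (↑U : X.left.Opens) := U.2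
  -- instances on `X` and on `A = Γ(X, U)`
  haveI : IsIntegral X.left := Motives.IsSmoothProjective.isIntegral_holds hX
  haveI := hX.smoothOfRelativeDimension
  haveI : LocallyOfFiniteType X.hom := by
    haveI : Smooth X.hom := SmoothOfRelativeDimension.smooth n _
    infer_instance
  letI : Algebra ℂ Γ(X.left, ↑U) := (SchemeOver.scalarRingHom X ↑U).toAlgebra
  haveI : Algebra.IsStandardSmoothOfRelativeDimension n ℂ Γ(X.left, ↑U) := hsm
  haveI : Nonempty (↑U : X.left.Opens) := ⟨⟨P.pt, hPU⟩⟩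
  haveI : IsDomain Γ(X.left, ↑U) := IsIntegral.component_integral (↑U : X.left.Opens)
  haveI : Algebra.IsStandardSmooth ℂ Γ(X.left, ↑U) :=
    Algebra.IsStandardSmoothOfRelativeDimension.isStandardSmooth n
  haveI : IsNoetherianRing Γ(X.left, ↑U) := Algebra.FiniteType.isNoetherianRing ℂ _
  -- the rational point `ψ = evaluation at P`, with kernel `𝔪_P`
  let ψ : Γ(X.left, ↑U) →ₐ[ℂ] ℂ :=
    { P.evalRingHom ↑U hPU with
      commutes' := fun a ↦ by
        change P.evalRingHom ↑U hPU (SchemeOver.scalarRingHom X ↑U a) = a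
        rw [AlgPoints.evalRingHom_apply, AlgPoints.eval_scalarRingHom]
        rfl }
  have hkerψ : RingHom.ker ψ = RingHom.ker (P.evalRingHom ↑U hPU) := rfl
  have hh'P : P.eval ↑U hPU h' ≠ 0 := fun h0 ↦ hhP (by
    rw [← AlgPoints.evalRingHom_apply, map_mul, AlgPoints.evalRingHom_apply,
      AlgPoints.evalRingHom_apply, h0, mul_zero])
  have hhP₁ : P.eval ↑U hPU h ≠ 0 := fun h0 ↦ hhP (by
    rw [← AlgPoints.evalRingHom_apply, map_mul, AlgPoints.evalRingHom_apply, h0, zero_mul])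
  have hh'ψ : h' ∉ RingHom.ker ψ := by
    rw [hkerψ, RingHom.mem_ker, AlgPoints.evalRingHom_apply]
    exact hh'P
  obtain ⟨hindep, t, ht, htspan⟩ := simplePointData_of_isRegularLocalRing ℂ Γ(X.left, ↑U) n 𝔭 hc
    g hg h' hgen ψ x (by rw [hkerψ]; exact hx) hreg hh'ψ
  have h𝔭𝔪 : 𝔭 ≤ RingHom.ker (P.evalRingHom ↑U hPU) := by
    rw [← hx]
    intro a ha
    change Ideal.Quotient.mk 𝔭 a ∈ x.asIdeal
    rw [Ideal.Quotient.eq_zero_iff_mem.2 ha]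
    exact zero_mem _
  -- the model `X(ℂ)` of `X^h` with algebraic charts
  choose chart mem alg hol using fun Q : ComplexPoints X ↦ exists_algebraicChart_holds X n Q
  letI cs : ChartedSpace (Fin n → ℂ) (ComplexPoints X) := chartedSpaceOfCharts chart mem
  haveI hM₀ : IsManifold 𝓘(ℂ, Fin n → ℂ) ω (ComplexPoints X) :=
    isManifold_chartedSpaceOfCharts chart mem alg hol
  haveI : IsManifold 𝓘(ℂ, Fin n → ℂ) 1 (ComplexPoints X) := IsManifold.of_le le_top
  have hid : IsAnalytification (Fin n → ℂ) X n (id : ComplexPoints X → ComplexPoints X) := by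
    refine ⟨IsHomeomorph.id, by simp, ?_⟩
    intro V s m hm
    simp only [Set.preimage_id_eq, id_eq, Set.mem_setOf_eq] at hm
    refine MDifferentiableAt.mdifferentiableWithinAt ?_
    rw [mdifferentiableAt_iff]
    refine ⟨(AlgPoints.continuousOn_evalOrZero _ s).continuousAt
      ((AlgPoints.isOpen_setOf_pt_mem _).mem_nhds hm), ?_⟩
    simp only [writtenInExtChartAt, extChartAt, OpenPartialHomeomorph.extend,
      modelWithCornersSelf_partialEquiv, PartialEquiv.trans_refl, modelWithCornersSelf_coe,
      Set.range_id, OpenPartialHomeomorph.toFun_eq_coe,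
      OpenPartialHomeomorph.coe_toPartialEquiv_symm]
    refine DifferentiableAt.differentiableWithinAt ?_
    have hopen : IsOpen ((chart m).target ∩ (chart m).symm ⁻¹' {Q | Q.pt ∈ (↑V : X.left.Opens)}) :=
      (chart m).isOpen_inter_preimage_symm (AlgPoints.isOpen_setOf_pt_mem _)
    have hmem : chart m m ∈ (chart m).target ∩ (chart m).symm ⁻¹' {Q | Q.pt ∈ (↑V : X.left.Opens)} :=
      ⟨(chart m).map_source (mem m), by
        simp only [Set.mem_preimage, Set.mem_setOf_eq, (chart m).left_inv (mem m)]; exact hm⟩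
    exact ((hol m V s).differentiableOn (by simp)).differentiableAt (hopen.mem_nhds hmem)
  have hmd : ∀ s : Γ(X.left, ↑U), MDifferentiableOn 𝓘(ℂ, Fin n → ℂ) 𝓘(ℂ, ℂ) (evalOrZero ↑U s)
      {Q : ComplexPoints X | Q.pt ∈ (↑U : X.left.Opens)} := fun s ↦
    hid.mdifferentiableOn_evalOrZero U s
  -- `Z(ℂ) ∩ D(h h')(ℂ) = {g = 0}`
  have hbasic : ∀ (Q : ComplexPoints X) (hQ : Q.pt ∈ (↑U : X.left.Opens)) (f : Γ(X.left, ↑U)),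
      Q.pt ∈ X.left.basicOpen f ↔ f ∉ (hU.primeIdealOf ⟨Q.pt, hQ⟩).asIdeal := fun Q hQ f ↦
    mem_basicOpen_iff_notMem_primeIdealOf hU ⟨Q.pt, hQ⟩ f
  have hevalmem : ∀ (Q : ComplexPoints X) (hQ : Q.pt ∈ (↑U : X.left.Opens)) (f : Γ(X.left, ↑U)),
      Q.eval ↑U hQ f = 0 ↔ f ∈ (hU.primeIdealOf ⟨Q.pt, hQ⟩).asIdeal := fun Q hQ f ↦
    not_iff_not.1 ((AlgPoints.pt_mem_basicOpen_iff Q hQ f).symm.trans (hbasic Q hQ f))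
  have hhP' : P.pt ∈ X.left.basicOpen (h * h') := (AlgPoints.pt_mem_basicOpen_iff P hPU _).2 hhP
  have hZeq : ∀ (Q : ComplexPoints X) (hQ : Q.pt ∈ X.left.basicOpen (h * h')),
      Q.pt ∈ Z ↔ ∀ j, Q.eval ↑U (X.left.basicOpen_le _ hQ) (g j) = 0 := by
    intro Q hQ
    have hQU : Q.pt ∈ (↑U : X.left.Opens) := X.left.basicOpen_le _ hQ
    set q := hU.primeIdealOf ⟨Q.pt, hQU⟩ with hqdef
    have hq : hU.fromSpec.base q = Q.pt := hU.fromSpec_primeIdealOf ⟨Q.pt, hQU⟩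
    have hhq : h * h' ∉ q.asIdeal := (hbasic Q hQU _).1 hQ
    have hh'q : h' ∉ q.asIdeal := fun hm ↦ hhq (Ideal.mul_mem_left _ _ hm)
    have hhq' : h ∉ q.asIdeal := fun hm ↦ hhq (Ideal.mul_mem_right _ _ hm)
    calc Q.pt ∈ Z ↔ hU.fromSpec.base q ∈ Z := by rw [hq]
      _ ↔ 𝔭 ≤ q.asIdeal := hiso q hhq'
      _ ↔ ∀ j, g j ∈ q.asIdeal := by
          refine ⟨fun hle j ↦ hle (hg j), fun hgq a ha ↦ ?_⟩
          have h1 : h' * a ∈ q.asIdeal := by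
            refine (Ideal.span_le.2 ?_ : Ideal.span (Set.range g) ≤ q.asIdeal) (hgen a ha)
            rintro _ ⟨j, rfl⟩
            exact hgq j
          exact (Ideal.IsPrime.mem_or_mem q.2 h1).resolve_left hh'q
      _ ↔ ∀ j, Q.eval ↑U hQU (g j) = 0 := by
          rw [hqdef]
          exact forall_congr' fun j ↦ (hevalmem Q hQU (g j)).symm
  -- the hypotheses of `isRegularPointOfCodim_of_simplePoint`, with `ℂ`-coefficients as scalars
  have htspan' : ∀ a ∈ RingHom.ker (P.evalRingHom ↑U hPU), ∃ coef : Fin n → ℂ,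
      a - ∑ i, SchemeOver.scalarRingHom X ↑U (coef i) * t i ∈
        RingHom.ker (P.evalRingHom ↑U hPU) ^ 2 := by
    intro a ha
    obtain ⟨coef, hcoef⟩ := htspan a (hkerψ ▸ ha)
    refine ⟨coef, ?_⟩
    simp only [Algebra.smul_def] at hcoef
    exact hcoef
  have hg' : ∀ j, g j ∈ RingHom.ker (P.evalRingHom ↑U hPU) := fun j ↦ h𝔭𝔪 (hg j)
  have hindep' : ∀ coef : Fin c → ℂ,
      ∑ j, SchemeOver.scalarRingHom X ↑U (coef j) * g j ∈ RingHom.ker (P.evalRingHom ↑U hPU) ^ 2 →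
        coef = 0 := by
    intro coef hmem
    refine hindep coef ?_
    simp only [Algebra.smul_def]
    exact hmem
  -- `P` is a regular point of codimension `c` of `Z(ℂ)` in the model, hence straightened
  have hregP : Literature.Geometry.Kaehler.IsRegularPointOfCodim 𝓘(ℂ, Fin n → ℂ)
      {Q : ComplexPoints X | Q.pt ∈ Z} c P :=
    isRegularPointOfCodim_of_simplePoint (chart P) rfl (mem P) (hol P) (alg P) U hPU hmd t htspan'
      g hg' hindep' (h * h') hhP' Z hZeq
  obtain ⟨K, e, hPe, he⟩ := hregP.exists_straightening
  exact ⟨K, e, hPe, he⟩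

end Point

/-! ### The closed exceptional set and the global statement -/

section Global

variable {n : ℕ} {X : SchemeOver ℂ}

/-- The kernel of evaluation at a complex point `P ∈ U(ℂ)` of an affine open `U` is the prime of
`Γ(X, U)` corresponding to the scheme point `pt P` (`IsAffineOpen.primeIdealOf`): `f(P) = 0` iff
`pt P ∉ D(f)`. [folklore] -/
theorem ker_evalRingHom_eq_primeIdealOf {U : X.left.Opens} (hU : IsAffineOpen U)
    (P : ComplexPoints X) (hPU : P.pt ∈ U) :
    RingHom.ker (P.evalRingHom U hPU) = (hU.primeIdealOf ⟨P.pt, hPU⟩).asIdeal := by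
  ext f
  rw [RingHom.mem_ker, AlgPoints.evalRingHom_apply]
  exact not_iff_not.1 ((AlgPoints.pt_mem_basicOpen_iff P hPU f).symm.trans
    (mem_basicOpen_iff_notMem_primeIdealOf hU ⟨P.pt, hPU⟩ f))

/-- Points of an affine open `U = Spec A` and a Zariski-closed `Z`: `fromSpec q ∈ Z` iff `q`
contains the vanishing ideal of the preimage of `Z`. [folklore] -/
theorem fromSpec_mem_iff_vanishingIdeal_le {U : X.left.Opens} (hU : IsAffineOpen U)
    {Z : Set X.left} (hZ : IsClosed Z) (q : PrimeSpectrum Γ(X.left, U)) :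
    hU.fromSpec.base q ∈ Z ↔
      PrimeSpectrum.vanishingIdeal (hU.fromSpec.base ⁻¹' Z) ≤ q.asIdeal := by
  have hZ'cl : IsClosed (hU.fromSpec.base ⁻¹' Z) := hZ.preimage hU.fromSpec.base.hom.continuous
  have h1 : PrimeSpectrum.zeroLocus
      (PrimeSpectrum.vanishingIdeal (hU.fromSpec.base ⁻¹' Z) : Set Γ(X.left, U)) =
      hU.fromSpec.base ⁻¹' Z := by
    rw [PrimeSpectrum.zeroLocus_vanishingIdeal_eq_closure]
    exact hZ'cl.closure_eq
  change q ∈ hU.fromSpec.base ⁻¹' Z ↔ _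
  rw [← h1]
  rfl

/-- **Off a closed subset of larger codimension, a Zariski-closed subset is locally flat in
`X(ℂ)`** (Serre, GAGA §6 Cor. 3 at simple points; the algebraic case of Voisin I Thm. 11.11, one
step). Let `X` be smooth projective of dimension `n` over `ℂ` and `Z ⊆ X` Zariski-closed with every
point of codimension `≥ c`. Then there is a Zariski-closed `Z₁ ⊆ Z` with every point of
codimension `≥ c + 1` such that for every complex point `P` with `pt P ∈ Z ∖ Z₁` there are
`c' ≥ c`, a subspace `K ⊆ ℂⁿ` and an open partial homeomorphism `e : X(ℂ) ⇀ ℂ^{c'} × K` (strong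
topology) with `P ∈ e.source` and `pt Q ∈ Z ↔ (e Q).1 = 0` for `Q ∈ e.source`. `Z₁` is the set
of points of `Z` that are not GOOD, a point being good when, in some standard smooth affine chart,
it lies on `V(𝔭) ∩ D(h h')` for a prime `𝔭 ⊇ I(Z ∩ U)` isolated off `V(h)` with generators off
`V(h')`, at a smooth point of `A/𝔭` (`exists_straightening_of_witnesses`); good points form an
open subset of `Z` (the smooth locus is open, Mathlib `Algebra.isOpen_smoothLocus`) containing
every maximal point of `Z` (generic smoothness, `isSmoothAt_bot`; `exists_minimalPrime_forall_iff`,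
`exists_mul_mem_span_of_isRegularLocalRing`), whence the codimension bound.
[cite: SerreGAGA1956, §6 Prop. 3 Cor. 2–3 (p. 11) with §1 n°4 and §2 n°6 Cor. 2]
[cite: VoisinHodgeI2002, §11.1.1 Thm. 11.11] [cite: GortzWedhorn2020, Thm. 6.19 and Lemma 6.26] -/
theorem exists_closed_straightening_off (hX : Motives.IsSmoothProjective n X) {Z : Set X.left}
    (hZ : IsClosed Z) {c : ℕ} (hcZ : ∀ z ∈ Z, (c : ℕ∞) ≤ Order.coheight z) :
    ∃ Z₁ : Set X.left, IsClosed Z₁ ∧ Z₁ ⊆ Z ∧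
      (∀ z ∈ Z₁, ((c + 1 : ℕ) : ℕ∞) ≤ Order.coheight z) ∧
      ∀ P : ComplexPoints X, P.pt ∈ Z → P.pt ∉ Z₁ →
        ∃ (c' : ℕ) (K : Submodule ℂ (Fin n → ℂ))
          (e : OpenPartialHomeomorph (ComplexPoints X) ((Fin c' → ℂ) × K)),
          c ≤ c' ∧ P ∈ e.source ∧ ∀ Q ∈ e.source, Q.pt ∈ Z ↔ (e Q).1 = 0 := by
  classical
  -- instances on `X`
  haveI : IsIntegral X.left := Motives.IsSmoothProjective.isIntegral_holds hX
  haveI := hX.smoothOfRelativeDimension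
  haveI : LocallyOfFiniteType X.hom := by
    haveI : Smooth X.hom := SmoothOfRelativeDimension.smooth n _
    infer_instance
  -- ring-theoretic instances on a standard smooth affine chart
  have chartInst : ∀ (U : X.left.affineOpens), (↑(↑U : X.left.Opens) : Set X.left).Nonempty →
      RingHom.IsStandardSmoothOfRelativeDimension n (SchemeOver.scalarRingHom X ↑U) →
      letI : Algebra ℂ Γ(X.left, ↑U) := (SchemeOver.scalarRingHom X ↑U).toAlgebra
      IsDomain Γ(X.left, ↑U) ∧ Algebra.IsStandardSmoothOfRelativeDimension n ℂ Γ(X.left, ↑U) ∧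
        Algebra.FiniteType ℂ Γ(X.left, ↑U) ∧ IsNoetherianRing Γ(X.left, ↑U) := by
    intro U hne hsm
    letI : Algebra ℂ Γ(X.left, ↑U) := (SchemeOver.scalarRingHom X ↑U).toAlgebra
    haveI : Algebra.IsStandardSmoothOfRelativeDimension n ℂ Γ(X.left, ↑U) := hsm
    obtain ⟨z, hz⟩ := hne
    haveI : Nonempty (↑U : X.left.Opens) := ⟨⟨z, hz⟩⟩
    haveI : IsDomain Γ(X.left, ↑U) := IsIntegral.component_integral (↑U : X.left.Opens)
    haveI : Algebra.IsStandardSmooth ℂ Γ(X.left, ↑U) :=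
      Algebra.IsStandardSmoothOfRelativeDimension.isStandardSmooth n
    haveI : Algebra.FiniteType ℂ Γ(X.left, ↑U) := inferInstance
    exact ⟨inferInstance, hsm, inferInstance, Algebra.FiniteType.isNoetherianRing ℂ _⟩
  -- the good points
  let Good : X.left → Prop := fun z ↦ ∃ (U : X.left.affineOpens) (hzU : z ∈ (↑U : X.left.Opens))
    (_ : RingHom.IsStandardSmoothOfRelativeDimension n (SchemeOver.scalarRingHom X ↑U))
    (𝔭 : Ideal Γ(X.left, ↑U)) (_ : 𝔭.IsPrime) (c' : ℕ) (_ : (c' : ℕ∞) = 𝔭.height)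
    (g : Fin c' → Γ(X.left, ↑U)) (_ : ∀ j, g j ∈ 𝔭) (h h' : Γ(X.left, ↑U))
    (_ : ∀ a ∈ 𝔭, h' * a ∈ Ideal.span (Set.range g))
    (_ : ∀ q : PrimeSpectrum Γ(X.left, ↑U), h ∉ q.asIdeal →
      (U.2.fromSpec.base q ∈ Z ↔ 𝔭 ≤ q.asIdeal))
    (x : PrimeSpectrum (Γ(X.left, ↑U) ⧸ 𝔭)),
    x.asIdeal.comap (Ideal.Quotient.mk 𝔭) = (U.2.primeIdealOf ⟨z, hzU⟩).asIdeal ∧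
    (letI : Algebra ℂ Γ(X.left, ↑U) := (SchemeOver.scalarRingHom X ↑U).toAlgebra;
      x ∈ Algebra.smoothLocus ℂ (Γ(X.left, ↑U) ⧸ 𝔭)) ∧
    h * h' ∉ (U.2.primeIdealOf ⟨z, hzU⟩).asIdeal ∧ c ≤ c'
  -- (1) good points are straightened
  have hstraight : ∀ P : ComplexPoints X, Good P.pt →
      ∃ (c' : ℕ) (K : Submodule ℂ (Fin n → ℂ))
        (e : OpenPartialHomeomorph (ComplexPoints X) ((Fin c' → ℂ) × K)),
        c ≤ c' ∧ P ∈ e.source ∧ ∀ Q ∈ e.source, Q.pt ∈ Z ↔ (e Q).1 = 0 := by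
    rintro P ⟨U, hPU, hsm, 𝔭, h𝔭, c', hc', g, hg, h, h', hgen, hiso, x, hx, hxsm, hhh', hcc'⟩
    letI : Algebra ℂ Γ(X.left, ↑U) := (SchemeOver.scalarRingHom X ↑U).toAlgebra
    obtain ⟨_, _, _, _⟩ := chartInst U ⟨P.pt, hPU⟩ hsm
    haveI : Algebra.FiniteType ℂ (Γ(X.left, ↑U) ⧸ 𝔭) :=
      Algebra.FiniteType.of_surjective (Ideal.Quotient.mkₐ ℂ 𝔭) Ideal.Quotient.mk_surjective
    haveI : Algebra.FinitePresentation ℂ (Γ(X.left, ↑U) ⧸ 𝔭) :=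
      (Algebra.FinitePresentation.of_finiteType).mp ‹_›
    have hreg := isRegularLocalRing_of_mem_smoothLocus ℂ (Γ(X.left, ↑U) ⧸ 𝔭) x hxsm
    have hhP : P.eval ↑U hPU (h * h') ≠ 0 := by
      intro h0
      apply hhh'
      rw [← ker_evalRingHom_eq_primeIdealOf U.2 P hPU, RingHom.mem_ker, AlgPoints.evalRingHom_apply]
      exact h0
    obtain ⟨K, e, hPe, he⟩ := exists_straightening_of_witnesses hX U hsm 𝔭 hc' g hg h h' hgen hiso
      P hPU x (hx.trans (ker_evalRingHom_eq_primeIdealOf U.2 P hPU).symm) hreg hhP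
    exact ⟨c', K, e, hcc', hPe, he⟩
  -- (2) the good points of `Z` form an open subset of `Z`
  have hopen : ∀ z, Good z → ∃ O : Set X.left, IsOpen O ∧ z ∈ O ∧ ∀ y ∈ O, y ∈ Z → Good y := by
    rintro z ⟨U, hzU, hsm, 𝔭, h𝔭, c', hc', g, hg, h, h', hgen, hiso, x, hx, hxsm, hhh', hcc'⟩
    have hU : IsAffineOpen (↑U : X.left.Opens) := U.2
    letI : Algebra ℂ Γ(X.left, ↑U) := (SchemeOver.scalarRingHom X ↑U).toAlgebra
    obtain ⟨_, _, _, _⟩ := chartInst U ⟨z, hzU⟩ hsm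
    haveI : Algebra.FiniteType ℂ (Γ(X.left, ↑U) ⧸ 𝔭) :=
      Algebra.FiniteType.of_surjective (Ideal.Quotient.mkₐ ℂ 𝔭) Ideal.Quotient.mk_surjective
    haveI : Algebra.FinitePresentation ℂ (Γ(X.left, ↑U) ⧸ 𝔭) :=
      (Algebra.FinitePresentation.of_finiteType).mp ‹_›
    -- the open set: `D(h h')` minus the (closed) image of the non-smooth locus of `A/𝔭`
    set Bad : Set (PrimeSpectrum Γ(X.left, ↑U)) :=
      PrimeSpectrum.comap (Ideal.Quotient.mk 𝔭) '' (Algebra.smoothLocus ℂ (Γ(X.left, ↑U) ⧸ 𝔭))ᶜ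
      with hBad
    have hBadcl : IsClosed Bad :=
      (PrimeSpectrum.isClosedEmbedding_comap_of_surjective _ _ Ideal.Quotient.mk_surjective).isClosedMap
        _ Algebra.isOpen_smoothLocus.isClosed_compl
    set W : Set (PrimeSpectrum Γ(X.left, ↑U)) :=
      (PrimeSpectrum.basicOpen (h * h') : Set (PrimeSpectrum Γ(X.left, ↑U))) ∩ Badᶜ with hW
    have hWo : IsOpen W := (PrimeSpectrum.basicOpen (h * h')).2.inter hBadcl.isOpen_compl
    refine ⟨hU.fromSpec.base '' W, hU.fromSpec.isOpenEmbedding.isOpenMap _ hWo, ?_, ?_⟩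
    · -- `z ∈ O`
      refine ⟨hU.primeIdealOf ⟨z, hzU⟩, ⟨?_, ?_⟩, hU.fromSpec_primeIdealOf ⟨z, hzU⟩⟩
      · exact (PrimeSpectrum.mem_basicOpen _ _).2 hhh'
      · rintro ⟨y, hy, hyq⟩
        apply hy
        have hyx : y = x := PrimeSpectrum.comap_injective_of_surjective _ Ideal.Quotient.mk_surjective
          (by rw [hyq]; exact PrimeSpectrum.ext hx.symm)
        rw [hyx]
        exact hxsm
    · -- every point of `O ∩ Z` is good, with the same witnesses
      rintro y ⟨q', hq'W, rfl⟩ hyZ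
      have hyU : hU.fromSpec.base q' ∈ (↑U : X.left.Opens) := by
        have hr : hU.fromSpec.base q' ∈ Set.range hU.fromSpec := ⟨q', rfl⟩
        rwa [hU.range_fromSpec] at hr
      have hq' : hU.primeIdealOf ⟨hU.fromSpec.base q', hyU⟩ = q' :=
        hU.fromSpec.isOpenEmbedding.injective (hU.fromSpec_primeIdealOf ⟨_, hyU⟩)
      have hhq' : h * h' ∉ q'.asIdeal := (PrimeSpectrum.mem_basicOpen _ _).1 hq'W.1
      have hhq'₁ : h ∉ q'.asIdeal := fun hm ↦ hhq' (Ideal.mul_mem_right _ _ hm)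
      have h𝔭q' : 𝔭 ≤ q'.asIdeal := (hiso q' hhq'₁).1 hyZ
      have hker : RingHom.ker (Ideal.Quotient.mk 𝔭) ≤ q'.asIdeal := by rwa [Ideal.mk_ker]
      let x' : PrimeSpectrum (Γ(X.left, ↑U) ⧸ 𝔭) :=
        ⟨q'.asIdeal.map (Ideal.Quotient.mk 𝔭),
          Ideal.map_isPrime_of_surjective Ideal.Quotient.mk_surjective hker⟩
      have hx' : x'.asIdeal.comap (Ideal.Quotient.mk 𝔭) = q'.asIdeal := by
        change (q'.asIdeal.map (Ideal.Quotient.mk 𝔭)).comap (Ideal.Quotient.mk 𝔭) = q'.asIdeal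
        rw [Ideal.comap_map_of_surjective _ Ideal.Quotient.mk_surjective,
          ← RingHom.ker_eq_comap_bot, Ideal.mk_ker]
        exact sup_eq_left.2 h𝔭q'
      have hx'sm : x' ∈ Algebra.smoothLocus ℂ (Γ(X.left, ↑U) ⧸ 𝔭) := by
        by_contra hns
        exact hq'W.2 ⟨x', hns, PrimeSpectrum.ext hx'⟩
      refine ⟨U, hyU, hsm, 𝔭, h𝔭, c', hc', g, hg, h, h', hgen, hiso, x', ?_, hx'sm, ?_, hcc'⟩
      · rw [hq']
        exact hx'
      · rw [hq']
        exact hhq'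
  -- (3) maximal points of `Z` are good
  have hmaximal : ∀ η ∈ Z, (∀ y ∈ Z, y ⤳ η → y = η) → Good η := by
    intro η hηZ hmax
    -- a standard smooth affine chart `U = Spec A ∋ η`
    obtain ⟨U₀, hU, hηU, hsm⟩ := exists_isStandardSmoothOfRelativeDimension_scalarRingHom' X n η
    let U : X.left.affineOpens := ⟨U₀, hU⟩
    letI : Algebra ℂ Γ(X.left, ↑U) := (SchemeOver.scalarRingHom X ↑U).toAlgebra
    obtain ⟨_, _, _, _⟩ := chartInst U ⟨η, hηU⟩ hsm
    -- the ideal of `Z ∩ U` and the prime of `η`, a minimal prime of it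
    set I : Ideal Γ(X.left, ↑U) := PrimeSpectrum.vanishingIdeal (hU.fromSpec.base ⁻¹' Z) with hIdef
    have hZI : ∀ q : PrimeSpectrum Γ(X.left, ↑U), hU.fromSpec.base q ∈ Z ↔ I ≤ q.asIdeal :=
      fromSpec_mem_iff_vanishingIdeal_le hU hZ
    set qη : PrimeSpectrum Γ(X.left, ↑U) := hU.primeIdealOf ⟨η, hηU⟩ with hqηdef
    have hqη : hU.fromSpec.base qη = η := hU.fromSpec_primeIdealOf ⟨η, hηU⟩
    have hIq : I ≤ qη.asIdeal := (hZI qη).1 (by rw [hqη]; exact hηZ)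
    have hqmin : ∀ q : PrimeSpectrum Γ(X.left, ↑U), I ≤ q.asIdeal → q.asIdeal ≤ qη.asIdeal →
        qη.asIdeal ≤ q.asIdeal := by
      intro q hIq' hle
      have hyZ : hU.fromSpec.base q ∈ Z := (hZI q).2 hIq'
      have hspec : hU.fromSpec.base q ⤳ η := by
        rw [← hqη]
        exact ((PrimeSpectrum.le_iff_specializes q qη).1 hle).map hU.fromSpec.base.hom.continuous
      have heq : q = qη := hU.fromSpec.isOpenEmbedding.injective ((hmax _ hyZ hspec).trans hqη.symm)
      rw [heq]
    -- `qη` isolated off `V(h)`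
    obtain ⟨𝔭', h𝔭'min, h𝔭'le, h, hh𝔭', hiso'⟩ :=
      exists_minimalPrime_forall_iff I qη.asIdeal hIq
    have h𝔭'eq : 𝔭' = qη.asIdeal :=
      le_antisymm h𝔭'le (hqmin ⟨𝔭', h𝔭'min.1.1⟩ h𝔭'min.1.2 h𝔭'le)
    have hhq : h ∉ qη.asIdeal := h𝔭'eq ▸ hh𝔭'
    have hiso : ∀ q : PrimeSpectrum Γ(X.left, ↑U), h ∉ q.asIdeal →
        (hU.fromSpec.base q ∈ Z ↔ qη.asIdeal ≤ q.asIdeal) := fun q hq ↦ by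
      rw [hZI q, ← h𝔭'eq]
      exact hiso' q.asIdeal q.2 hq
    -- generators of `qη` off `V(h')`
    set 𝔭 : Ideal Γ(X.left, ↑U) := qη.asIdeal with h𝔭def
    haveI h𝔭prime : 𝔭.IsPrime := qη.2
    obtain ⟨c', hc'⟩ : ∃ c' : ℕ, 𝔭.height = c' := by
      obtain ⟨c', hc'⟩ := ENat.ne_top_iff_exists.mp (Ideal.height_ne_top_of_isPrime (I := 𝔭))
      exact ⟨c', hc'.symm⟩
    haveI := Literature.AlgebraicGeometry.Motives.isRegularLocalRing_of_isStandardSmoothOfRelativeDimension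
      ℂ n 𝔭
    have hdim𝔭 : ringKrullDim (Localization.AtPrime 𝔭) = c' := by
      rw [IsLocalization.AtPrime.ringKrullDim_eq_height 𝔭, hc']
      rfl
    obtain ⟨g, hg, h', hh', hgen⟩ := exists_mul_mem_span_of_isRegularLocalRing 𝔭 hdim𝔭
    -- the generic point of `A/𝔭` is smooth
    haveI : IsDomain (Γ(X.left, ↑U) ⧸ 𝔭) := Ideal.Quotient.isDomain 𝔭
    haveI : Algebra.FiniteType ℂ (Γ(X.left, ↑U) ⧸ 𝔭) :=
      Algebra.FiniteType.of_surjective (Ideal.Quotient.mkₐ ℂ 𝔭) Ideal.Quotient.mk_surjective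
    let x : PrimeSpectrum (Γ(X.left, ↑U) ⧸ 𝔭) := ⟨⊥, Ideal.isPrime_bot⟩
    have hx : x.asIdeal.comap (Ideal.Quotient.mk 𝔭) = qη.asIdeal := by
      change (⊥ : Ideal (Γ(X.left, ↑U) ⧸ 𝔭)).comap (Ideal.Quotient.mk 𝔭) = 𝔭
      rw [← RingHom.ker_eq_comap_bot, Ideal.mk_ker]
    have hxsm : x ∈ Algebra.smoothLocus ℂ (Γ(X.left, ↑U) ⧸ 𝔭) := isSmoothAt_bot ℂ (Γ(X.left, ↑U) ⧸ 𝔭)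
    -- the height of `qη` is the codimension of `η`
    have hcc' : c ≤ c' := by
      have h3 : (c : ℕ∞) ≤ Order.coheight (hU.fromSpec.base qη) := by
        rw [hqη]
        exact hcZ η hηZ
      rw [coheight_eq_of_isOpenImmersion hU.fromSpec, ← idealHeight_eq_coheight _ qη,
        show qη.asIdeal = 𝔭 from rfl, hc'] at h3
      exact_mod_cast h3
    refine ⟨U, hηU, hsm, 𝔭, h𝔭prime, c', hc'.symm, g, hg, h, h', hgen, hiso, x, hx, hxsm, ?_, hcc'⟩
    exact fun hm ↦ (Ideal.IsPrime.mem_or_mem inferInstance hm).elim hhq hh'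
  -- the exceptional set
  choose O hO using hopen
  refine ⟨{z | z ∈ Z ∧ ¬Good z}, ?_, fun z hz ↦ hz.1, ?_, ?_⟩
  · -- closed: `Z ∖ ⋃ O`
    have heq : {z | z ∈ Z ∧ ¬Good z} = Z ∩ (⋃ (z : X.left) (hz : Good z), O z hz)ᶜ := by
      ext y
      simp only [Set.mem_setOf_eq, Set.mem_inter_iff, Set.mem_compl_iff, Set.mem_iUnion, not_exists]
      constructor
      · rintro ⟨hyZ, hy⟩
        exact ⟨hyZ, fun z hz hyO ↦ hy ((hO z hz).2.2 y hyO hyZ)⟩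
      · rintro ⟨hyZ, hy⟩
        exact ⟨hyZ, fun hyg ↦ hy y hyg (hO y hyg).2.1⟩
    rw [heq]
    exact hZ.inter (isOpen_iUnion fun z ↦ isOpen_iUnion fun hz ↦ (hO z hz).1).isClosed_compl
  · -- codimension `≥ c + 1`
    rintro z ⟨hzZ, hzbad⟩
    -- a maximal point `η` of `Z` specialising to `z`: minimise the codimension
    let S : Set X.left := {y | y ∈ Z ∧ y ⤳ z}
    have hzS : z ∈ S := ⟨hzZ, specializes_rfl⟩
    let η : X.left := Function.argminOn (fun y ↦ Order.coheight y) S ⟨z, hzS⟩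
    obtain ⟨hηZ, hηz⟩ : η ∈ S := Function.argminOn_mem _ S ⟨z, hzS⟩
    have hmin : ∀ y ∈ S, Order.coheight η ≤ Order.coheight y := fun y hy ↦
      Function.argminOn_le (fun y ↦ Order.coheight y) S hy
    have hfin : ∀ y : X.left, Order.coheight y ≠ ⊤ := fun y ↦ by
      obtain ⟨a, b, -, hb, -⟩ := exists_height_eq_coheight_eq hX y
      rw [hb]
      exact ENat.coe_ne_top b
    have hmax : ∀ y ∈ Z, y ⤳ η → y = η := by
      intro y hyZ hyη
      by_contra hne
      have hyS : y ∈ S := ⟨hyZ, hyη.trans hηz⟩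
      have hlt : η < y := lt_of_le_not_ge (Scheme.le_iff_specializes.2 hyη)
        fun hle ↦ hne (hyη.antisymm (Scheme.le_iff_specializes.1 hle)).eq
      have h1 := Order.coheight_add_one_le hlt
      have h2 := hmin y hyS
      obtain ⟨k, hk⟩ := ENat.ne_top_iff_exists.mp (hfin y)
      rw [← hk] at h1 h2
      have h3 : (k : ℕ∞) + 1 ≤ k := h1.trans h2
      exact absurd (by exact_mod_cast h3 : k + 1 ≤ k) (by omega)
    have hηgood : Good η := hmaximal η hηZ hmax
    have hne : z ≠ η := fun h ↦ hzbad (h ▸ hηgood)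
    have hlt : z < η := lt_of_le_not_ge (Scheme.le_iff_specializes.2 hηz)
      fun hle ↦ hne ((Scheme.le_iff_specializes.1 hle).antisymm hηz).eq
    have h1 := Order.coheight_add_one_le hlt
    have h2 : (c : ℕ∞) + 1 ≤ Order.coheight η + 1 := add_le_add (hcZ η hηZ) le_rfl
    have h3 := h2.trans h1
    exact_mod_cast h3
  · -- straightening off the exceptional set
    intro P hPZ hP
    have hgood : Good P.pt := by
      by_contra hng
      exact hP ⟨hPZ, hng⟩
    exact hstraight P hgood

end Global

end GAGADimension

end Literature.AlgebraicGeometry.HodgeTheory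

end
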